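import Summits.CriticalPhenomena.SAWScalingLimit.Theorems.SAWLoopFugacityFlowIsingBoundaryRatioCruxGlue
import HarnessLib

/-!
# Crux `IsingBoundaryRatio` (stmt-CriticalPhenomena-10650, route `SAWLoopFugacityFlow`), line
`fk-anchor-transfer`: the crux conditionally on two printed theorems

`IsingBoundaryRatio_of_facts`: the route declaration
`Summit.CriticalPhenomena.SAWScalingLimit.Theses.SAWLoopFugacityFlow.IsingBoundaryRatio` (convergence of the
nested ratio of free critical Ising boundary two-point functions of a hull subdomain `D' ⊆ D` to
`Φ'_A(0)^{1/2}`) follows from the two printed named facts of the Literature tree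

* `Literature.Probability.LatticeModels.fkIsing_topologicalRectangle_crossingBounds` — CDH16 Thm 1.1
  (Chelkak–Duminil-Copin–Hongler 2016: crossing bounds for the critical FK–Ising model in discrete
  topological rectangles, uniformly in the boundary conditions), and
* `Literature.Probability.LatticeModels.chi_twoPoint_free_jordan` — CHI15 Thm 1.1, free boundary conditions
  (Chelkak–Hongler–Izyurov 2015: scaling limit of bulk spin correlations, here for Jordan domains with free
  boundary conditions),

by the glue `CruxGlue.IsingBoundaryRatio_of` of `Theorems/SAWLoopFugacityFlowIsingBoundaryRatioCruxGlue.lean`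
(anchor locality from the FK heart, anchor transfer, bulk free ratio, boundary fusion). The crux is thus
CONDITIONAL: its trust base is exactly these two named facts.
-/

namespace Summit.CriticalPhenomena.SAWScalingLimit.Theorems.IsingBoundaryRatio

/-- **The crux `IsingBoundaryRatio` of route `SAWLoopFugacityFlow`, conditionally on the two printed
theorems** CDH16 Thm 1.1 (`fkIsing_topologicalRectangle_crossingBounds`, Chelkak–Duminil-Copin–Hongler 2016,
crossing bounds in topological rectangles) and CHI15 Thm 1.1 with free boundary conditions
(`chi_twoPoint_free_jordan`, Chelkak–Hongler–Izyurov 2015, bulk spin correlations): line `fk-anchor-transfer`,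
composition `CruxGlue.IsingBoundaryRatio_of`. [folklore] -/
theorem IsingBoundaryRatio_of_facts :
    Literature.Probability.LatticeModels.fkIsing_topologicalRectangle_crossingBounds →
      Literature.Probability.LatticeModels.chi_twoPoint_free_jordan →
      Summit.CriticalPhenomena.SAWScalingLimit.Theses.SAWLoopFugacityFlow.IsingBoundaryRatio :=
  fun hf hX => CruxGlue.IsingBoundaryRatio_of hf hX

end Summit.CriticalPhenomena.SAWScalingLimit.Theorems.IsingBoundaryRatio
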